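import Summits.CriticalPhenomena.CardyFormulaZ2.Theses.CardyViaSLE6
import Literature.Probability.RandomPlanarGeometry.SLETwoPointItoProofs
import Literature.Probability.RandomPlanarGeometry.LocalMartingaleProofs
import HarnessLib

/-!
# Route `CardyViaSLE6`: the portmanteau assembly (stmt-CriticalPhenomena-11315)

Sub-problem `CriticalPhenomena/CardyFormulaZ2`, route `CardyViaSLE6`, assembly item
`Summit.CriticalPhenomena.CardyFormulaZ2.Theses.CardyViaSLE6.Assembly`:
`SLE6InterfaceLimit → InterfaceImpliesCrossing → CrossingImpliesInterface → SLE6HittingSandwich →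
DiscretisationsExist → CardyFormulaZ2` — SLE₆ for every Dobrushin domain and every admissible
`ℤ²`-discretisation family, together with the lattice crossing/interface dictionary, the SLE₆
hitting sandwich and the existence of discretisation families, gives Cardy's formula for bond
percolation on `ℤ²`.  This file PROVES it (the measure theory is done here; the four other
hypotheses are the route's items):

* `InterfaceImpliesCrossing` (stmt-CriticalPhenomena-11317),
* `CrossingImpliesInterface` (stmt-CriticalPhenomena-11318),
* `SLE6HittingSandwich` (stmt-CriticalPhenomena-8608),
* `DiscretisationsExist` (stmt-CriticalPhenomena-11319).

Main results:

* `eventually_lt_measureReal_preimage_of_tendstoLaw` — open-set portmanteau along `𝓝[>] 0` in the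
  tree's `TendstoLaw` format with only EVENTUAL a.e.-measurability (regularise the family off the
  measurable range, `tendstoLaw_iff_tendstoInDistribution`, Mathlib's
  `ProbabilityMeasure.le_liminf_measure_open_of_tendsto`);
* `disjoint_image_hitsBeforeApprox` — the approximants "`a`-close to `A` before `b`-close to `B`"
  and "`a'`-close to `B` before `b'`-close to `A`" are disjoint once `a ≤ b'` and `a' ≤ b`;
* `assembly_proof : Theses.CardyViaSLE6.Assembly` — the assembly item, proved.

The SLE₆ input is the tree's PROVED Cardy–Smirnov law `sle_six_measureReal_hitsBefore_holds`
(`μ(hits (cd) before (bc)) = F(η)` for every SLE₆ law in `(Ω; a, c)`).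
-/

noncomputable section

open Set Filter Topology Metric MeasureTheory
open scoped NNReal ENNReal
open Literature.Probability Literature.Probability.RandomPlanarGeometry
  Literature.Probability.LatticeModels Literature.Probability.Percolation

namespace Summit.CriticalPhenomena.CardyFormulaZ2.Theorems.CardyViaSLE6

/-! ### Open-set portmanteau along the mesh filter -/

/-- **Open-set portmanteau along `𝓝[>] 0`** in the `TendstoLaw` format: if `Y δ → Z` in law
(bounded continuous test functions) with `Y δ` a.e.-measurable for all small `δ` and `Z`
a.e.-measurable, then for every open `G` and `ε > 0`, eventually
`Law(Z)(G) - ε < P(Y δ ∈ G)`.  The family is first regularised to be a.e.-measurable at every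
mesh (which changes nothing eventually), then Mathlib's
`ProbabilityMeasure.le_liminf_measure_open_of_tendsto` applies. (Billingsley 1999, Thm 2.1.)
[folklore] -/
theorem eventually_lt_measureReal_preimage_of_tendstoLaw {Ω Ω' X : Type*} [MeasurableSpace Ω]
    [MeasurableSpace Ω'] [PseudoEMetricSpace X] [MeasurableSpace X] [BorelSpace X] [Nonempty X]
    {P : Measure Ω} [IsProbabilityMeasure P] {W : Measure Ω'} [IsProbabilityMeasure W]
    {Y : ℝ → Ω → X} {Z : Ω' → X} (hZ : AEMeasurable Z W)
    (hY : ∀ᶠ δ in 𝓝[>] (0 : ℝ), AEMeasurable (Y δ) P)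
    (hlaw : TendstoLaw (Ωδ := fun _ => Ω) Y (fun _ => P) Z W)
    {G : Set X} (hG : IsOpen G) {ε : ℝ} (hε : 0 < ε) :
    ∀ᶠ δ in 𝓝[>] (0 : ℝ), (W.map Z).real G - ε < P.real (Y δ ⁻¹' G) := by
  classical
  -- regularise the family off the (eventually full) a.e.-measurable range
  set Y' : ℝ → Ω → X := fun δ => if AEMeasurable (Y δ) P then Y δ else fun _ => Classical.arbitrary X
    with hY'def
  have hY' : ∀ δ, AEMeasurable (Y' δ) P := by
    intro δ
    by_cases h : AEMeasurable (Y δ) P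
    · simp only [hY'def, if_pos h]; exact h
    · simp only [hY'def, if_neg h]; exact aemeasurable_const
  have heq : ∀ᶠ δ in 𝓝[>] (0 : ℝ), Y' δ = Y δ := by
    filter_upwards [hY] with δ hδ
    simp only [hY'def, if_pos hδ]
  have hlaw' : TendstoLaw (Ωδ := fun _ => Ω) Y' (fun _ => P) Z W := by
    intro f
    refine (hlaw f).congr' ?_
    filter_upwards [heq] with δ hδ
    rw [hδ]
  have htd := (tendstoLaw_iff_tendstoInDistribution (Ωδ := fun _ => Ω) (P := fun _ => P) hY' hZ).1
    hlaw'
  have hli := ProbabilityMeasure.le_liminf_measure_open_of_tendsto htd.tendsto hG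
  simp only [ProbabilityMeasure.coe_mk] at hli
  -- `hli : W.map Z G ≤ liminf (fun δ => P.map (Y' δ) G)`
  set m : ℝ≥0∞ := W.map Z G with hm
  haveI : IsProbabilityMeasure (W.map Z) := Measure.isProbabilityMeasure_map hZ
  have hm_top : m ≠ ∞ := measure_ne_top _ _
  by_cases hm0 : m.toReal - ε < 0
  · filter_upwards with δ
    rw [measureReal_def]
    exact hm0.trans_le ENNReal.toReal_nonneg
  · rw [not_lt] at hm0
    have hmpos : m ≠ 0 := by
      intro h
      rw [h, ENNReal.toReal_zero] at hm0
      linarith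
    have hlt : m - ENNReal.ofReal ε < m :=
      ENNReal.sub_lt_self hm_top hmpos (by simpa using hε)
    have hev : ∀ᶠ δ in 𝓝[>] (0 : ℝ), m - ENNReal.ofReal ε < P.map (Y' δ) G :=
      Filter.eventually_lt_of_lt_liminf (hlt.trans_le hli)
    filter_upwards [hev, heq] with δ hδ hδ'
    haveI : IsProbabilityMeasure (P.map (Y' δ)) := Measure.isProbabilityMeasure_map (hY' δ)
    have h1 : (m - ENNReal.ofReal ε).toReal < (P.map (Y' δ) G).toReal :=
      (ENNReal.toReal_lt_toReal (ne_top_of_le_ne_top hm_top tsub_le_self) (measure_ne_top _ _)).2 hδ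
    have h2 : m.toReal - ε ≤ (m - ENNReal.ofReal ε).toReal := by
      have := ENNReal.le_toReal_sub (a := m) (b := ENNReal.ofReal ε) ENNReal.ofReal_ne_top
      rwa [ENNReal.toReal_ofReal hε.le] at this
    have h3 : P.map (Y' δ) G = P (Y δ ⁻¹' G) := by
      rw [Measure.map_apply_of_aemeasurable (hY' δ) hG.measurableSet, hδ']
    rw [measureReal_def, measureReal_def, ← h3]
    exact h2.trans_lt h1

/-! ### The two approximating hitting events are incompatible -/

/-- If `a ≤ b'` and `a' ≤ b`, no curve class lies both in "`a`-close to `A` at a time up to which it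
stayed `> b` away from `B`" and in "`a'`-close to `B` at a time up to which it stayed `> b'` away
from `A`": both events are open, hence saturated for reparametrisation distance `0`, so one
representative would satisfy both, and comparing the two witnessing times gives a contradiction.
[folklore] -/
theorem disjoint_image_hitsBeforeApprox {A B : Set ℂ} {a b a' b' : ℝ} (h₁ : a ≤ b') (h₂ : a' ≤ b) :
    Disjoint (CurveClass.mk '' CurveClass.hitsBeforeApprox A B a b)
      (CurveClass.mk '' CurveClass.hitsBeforeApprox B A a' b') := by
  rw [Set.disjoint_left]
  rintro c ⟨γ, hγ, rfl⟩ ⟨γ', hγ', hmk⟩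
  have hγ'' : γ ∈ CurveClass.hitsBeforeApprox B A a' b' :=
    CurveClass.mem_of_isOpen_of_dist_eq_zero (CurveClass.isOpen_hitsBeforeApprox _ _ _ _) hγ'
      (CurveClass.mk_eq_mk_iff_dist_eq_zero.1 hmk)
  obtain ⟨t, htA, htB⟩ := hγ
  obtain ⟨t', ht'B, ht'A⟩ := hγ''
  rcases le_or_gt t t' with htt | htt
  · have := ht'A t htt
    linarith
  · have := htB t' htt.le
    linarith

/-! ### The assembly -/

/-- **Portmanteau assembly** — the assembly item of route `CardyViaSLE6`
(stmt-CriticalPhenomena-11315) proved: SLE₆ for all admissible discretisation families, the two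
halves of the lattice crossing/interface dictionary with thickened open events, the SLE₆ hitting
sandwich and the existence of discretisation families imply Cardy's formula for bond-`ℤ²`.
Proof: fix `R`, `(φ, x)`; `D = R.chord 0 2`, a family `E` of `D`, the SLE₆ random curve `Γ` and its
law `μ` given by the hypothesis, `μ(hits (cd) before (bc)) = F(η)` by
`sle_six_measureReal_hitsBefore_holds`; with `U = {a-close to (cd) before b-close to (bc)}`,
`V = {b-close to (bc) before b'-close to (cd)}` (open, disjoint for `a ≤ b'`):
`P[C_δ] ≤ P[γ_δ ∈ U] + ε ≤ 1 - P[γ_δ ∈ V] + ε ≤ 1 - μ V + 2ε ≤ F(η) + 3ε` and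
`P[C_δ] ≥ P[γ_δ ∈ U] - ε ≥ μ U - 2ε ≥ F(η) - 3ε` eventually (open-set portmanteau twice).
(Smirnov 2001; Werner 2007, §3; Camia–Newman 2007, §5.) [folklore] -/
theorem assembly_proof : Theses.CardyViaSLE6.Assembly := by
  intro H h3 h4 hS hD R φ x hux
  haveI := isProbabilityMeasure_preWienerMeasure'
  haveI : Fact Process.isProjectiveLimit_preWienerMeasure := ⟨isProjectiveLimit_preWienerMeasure_holds⟩
  haveI : Nonempty (CurveClass ℂ) := ⟨CurveClass.mk ⟨ContinuousMap.const _ 0⟩⟩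
  rw [Metric.tendsto_nhds]
  intro e he
  obtain ⟨ε, hε, hεe⟩ : ∃ ε : ℝ, 0 < ε ∧ 3 * ε < e := ⟨e / 4, by positivity, by linarith⟩
  obtain ⟨E, hE⟩ := hD (R.chord 0 2 (by decide))
  obtain ⟨Γ, hΓ, hmeas, hlaw⟩ := H (R.chord 0 2 (by decide)) E hE
  set P : Measure (BondConfig (Site 2)) := bondPercolation (zdGraph 2) Percolation.half with hP
  set μ : Measure (CurveClass ℂ) := Process.preWienerMeasure.map Γ with hμdef
  have hμ : IsSLELaw 6 (R.chord 0 2 (by decide)) μ := hΓ.isSLELaw_map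
  haveI : IsProbabilityMeasure μ := hμ.isProbabilityMeasure
  have hF : μ.real (CurveClass.hitsBefore (R.arc 2) (R.arc 1)) =
      RandomPlanarGeometry.cardyFunction (crossRatio x) :=
    sle_six_measureReal_hitsBefore_holds R hμ hux
  -- parameters
  obtain ⟨b₁, hb₁, hS₁⟩ := hS R μ hμ ε hε
  obtain ⟨a₀, ha₀, h3'⟩ := h3 R E hE ε hε
  obtain ⟨b₀, hb₀, h4'⟩ := h4 R E hE ε hε
  obtain ⟨b, hb, hbb₁, hbb₀⟩ : ∃ b : ℝ, 0 < b ∧ b < b₁ ∧ b < b₀ :=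
    ⟨min b₁ b₀ / 2, by positivity, by linarith [min_le_left b₁ b₀], by linarith [min_le_right b₁ b₀]⟩
  obtain ⟨b', hb', hb'b₁⟩ : ∃ b' : ℝ, 0 < b' ∧ b' < b₁ := ⟨b₁ / 2, by positivity, by linarith⟩
  obtain ⟨a, ha, haa₀, hab'⟩ : ∃ a : ℝ, 0 < a ∧ a < a₀ ∧ a ≤ b' :=
    ⟨min (a₀ / 2) b', by positivity, by linarith [min_le_left (a₀ / 2) b'], min_le_right _ _⟩
  -- the two open events
  set U : Set (CurveClass ℂ) :=
    CurveClass.mk '' CurveClass.hitsBeforeApprox (R.arc 2) (R.arc 1) a b with hU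
  set V : Set (CurveClass ℂ) :=
    CurveClass.mk '' CurveClass.hitsBeforeApprox (R.arc 1) (R.arc 2) b b' with hV
  have hUo : IsOpen U :=
    SeparationQuotient.isOpenMap_mk _ (CurveClass.isOpen_hitsBeforeApprox _ _ _ _)
  have hVo : IsOpen V :=
    SeparationQuotient.isOpenMap_mk _ (CurveClass.isOpen_hitsBeforeApprox _ _ _ _)
  have hUV : Disjoint U V := disjoint_image_hitsBeforeApprox hab' le_rfl
  -- the SLE₆ sandwich
  have hS1 := (hS₁ b ⟨hb, hbb₁⟩ a ha).1
  have hS2 := (hS₁ b' ⟨hb', hb'b₁⟩ b hb).2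
  have huniv : μ.real univ = 1 := probReal_univ
  -- the lattice dictionary (eventually in the mesh)
  have h3e := h3' a ⟨ha, haa₀⟩ b hb
  have h4e := h4' b ⟨hb, hbb₀⟩ a ha
  -- portmanteau for the two open events
  have hpU := eventually_lt_measureReal_preimage_of_tendstoLaw (P := P) hΓ.aemeasurable hmeas hlaw
    hUo hε
  have hpV := eventually_lt_measureReal_preimage_of_tendstoLaw (P := P) hΓ.aemeasurable hmeas hlaw
    hVo hε
  filter_upwards [h3e, h4e, hpU, hpV, hmeas] with δ hδ3 hδ4 hδU hδV hδm
  -- one name for the interface at mesh `δ`, and every estimate restated in that vocabulary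
  set X : BondConfig (Site 2) → CurveClass ℂ :=
    Literature.Probability.Percolation.bondInterfaceIn (R.chord 0 2 (by decide)) (E δ) with hX
  have e3 : P.real (X ⁻¹' U) ≤ bondDomainCrossingProb R δ + ε := hδ3
  have e4 : bondDomainCrossingProb R δ ≤ P.real (X ⁻¹' U) + ε := hδ4
  have eU : μ.real U - ε < P.real (X ⁻¹' U) := hδU
  have eV : μ.real V - ε < P.real (X ⁻¹' V) := hδV
  have em : AEMeasurable X P := hδm
  have eS1 : μ.real (CurveClass.hitsBefore (R.arc 2) (R.arc 1)) ≤ μ.real U + ε := hS1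
  have eS2 : μ.real univ ≤ μ.real V + μ.real (CurveClass.hitsBefore (R.arc 2) (R.arc 1)) + ε := hS2
  -- disjointness in probability
  have hsum : P.real (X ⁻¹' U) + P.real (X ⁻¹' V) ≤ 1 := by
    have hAB : P (X ⁻¹' U) + P (X ⁻¹' V) ≤ 1 := by
      rw [← measure_union₀ (em.nullMeasurableSet_preimage hVo.measurableSet)
        (hUV.preimage _).aedisjoint]
      exact prob_le_one
    rw [measureReal_def, measureReal_def,
      ← ENNReal.toReal_add (measure_ne_top _ _) (measure_ne_top _ _)]
    calc _ ≤ (1 : ℝ≥0∞).toReal := ENNReal.toReal_mono ENNReal.one_ne_top hAB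
      _ = 1 := by simp
  clear hδ3 hδ4 hδU hδV hS1 hS2
  rw [Real.dist_eq, abs_sub_lt_iff]
  constructor <;> linarith

end Summit.CriticalPhenomena.CardyFormulaZ2.Theorems.CardyViaSLE6

end
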